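import Summits.CriticalPhenomena.PercolationContinuityZ3.Theorems.Transplant.SkelPhiCellsConcG
import Summits.CriticalPhenomena.PercolationContinuityZ3.Theorems.Transplant.SkelPhiWindowSpansCoarse
import Summits.CriticalPhenomena.PercolationContinuityZ3.Theorems.Transplant.PlanarCells2EfarN2
import Summits.CriticalPhenomena.PercolationContinuityZ3.Theorems.Transplant.TwoAxisParaCellsFine
import HarnessLib

/-!
# N1 ({±1} node) scheme geometry over a NON-STEP cell map (hp-8 g33; design owner's assignment 2026-08-21 13:26Z): WEAK STEPS, the record
# `Skelφ.cellGeomSG₂` (= `cellGeomSG` with the far region `EfarN₂`), and `RunGeom/AnchGeom/SepGeom/SepGeom₂` for ANY 1-Lipschitz window map with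
# weak steps — in particular for the fine cell map `Skelφ.fineSkel` (KIT-FRAMES-N1 (R3))

builds on p205010 (kernel theorem, internal audit signed; external expert review pending) — nothing in this file uses p205010; nothing here is a
claim about the open node `SamePDropOfSkeletonNeg`.
Lane `prim-bschramm`, seat `prim-hp-8` (gen 33); helper file (`--supports stmt-CriticalPhenomena-4575 --as helper`).
WHAT CHANGES against `SkelPhiCellsConcG` §3–§4 (p2-g7; everything else is its text with `φ ↦ ψ`):
(1) the step device `mem_VWin_of_zdAdj (hstep)` is replaced by **weak steps** `Skelφ.WeakSteps G ψ` (a neighbour whose `i`-th coordinate does not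
    move against a prescribed sign — true for `fineSkel` from `Steps G φ` alone, `weakSteps_fineSkel`, since floors are monotone) read through the
    SLACK BOXES of `PlanarCells2EfarN2` (the weak-step neighbour may move the other coordinate by one), and by p3-g8's MARGIN METHOD
    (`SkelPhiWindowMargin`) across a shared level — here also for staircase spans (`VStair_subset_union_of_margin`);
(2) the record is **`cellGeomSG₂`**: `cellGeomSG` with `Efar a v δ := VWin ψ (P.EfarN₂ v δ) (rE a v δ)` (transverse half-width `5r⊥ − 2`) — located:
    with `EfarN` the cover `Efar ⊆ Btw ∪ Q(v+δ)` can fail at a corner footprint over a non-step map; every other `Efar` fact is inherited from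
    `EfarN₂ ⊆ EfarN`;
(3) `root_mem` and `col_Q` take the hypotheses `hψ0 : ψ w₀ = 0` and `hcol` (a vertex with `ψ = cen x` inside `VWin (Q x) (rQ a x)` — discharged at
    instantiation by the fine representative lemma; stmt's `Nrep` slot).
* §1 `WeakSteps`, `weakSteps_of_steps`, `TwoAxis.Para.coarse_mono`, **`weakSteps_fineSkel`**, `exists_adj_upBox`, `exists_adj_downBox`, `VStair_subset_union_of_margin`;
* §2 **`cellGeomSG₂`**; §3 `runGeomSG₂`, `anchGeomSG₂`, **`sepGeomSG₂ (hlip) (hws) (hψ0) (hcol)`**, **`sepGeom₂SG₂`**.  `ExitGeom/StepsGeom/LevelGeom/QSepGeom`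
  are in the companion `SkelPhiCellsWeakGLevels` (400-line rule).
[cite: KozmaNitzan2024, §4 pp. 25–27, 30–31 (Q_v, M_v, E_{v,x}, H^j_{v,x}, F^j_{v,x})] [cite: MartineauTassion2017, §4.3]
-/

noncomputable section

open scoped Classical

namespace Summit.CriticalPhenomena.PercolationContinuityZ3.Theorems

namespace Transplant

namespace Skelφ

open Literature.Probability.Percolation Literature.Probability.LatticeModels SimpleGraph KNCells
open Literature.Probability.Percolation.KozmaNitzan
open Literature.Probability.Percolation.KozmaNitzan.Cells (oth oth_ne sgOf sgOf_sign stepVec_apply_fst stepVec_apply_oth eq_oth_of_ne oth_oth)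
open Literature.Barriers.CriticalPhenomena (graphBall graphBall_finite mem_graphBall_self graphBall_mono)
open BoxProdZ2 (ConcRadiiG)
open PlanarSkeletonConc (mem_vspan_edgesIn_iff mem_vspan_edgesIn_of_adj)

variable {V : Type} [DecidableEq V] {G : SimpleGraph V} [G.LocallyFinite] {ψ : V → Site 2}

/-! ## §1 Weak steps and the two devices (slack boxes, staircase margins) -/

variable (G) in
/-- **Weak steps** of a planar map: at every vertex, for every coordinate and sign, some neighbour whose coordinate does not move AGAINST the sign.
The replacement of `Skelφ.Steps` for the cell map of the {±1} node. [this work] -/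
def WeakSteps (ψ : V → Site 2) : Prop := ∀ (y : V) (i : Fin 2) (σ : ℤˣ), ∃ m, G.Adj y m ∧ 0 ≤ (σ : ℤ) * (ψ m i - ψ y i)

omit [DecidableEq V] [G.LocallyFinite] in
/-- Unit steps are weak steps. [folklore] -/
theorem weakSteps_of_steps (hstep : Steps G ψ) : WeakSteps G ψ := fun y i σ => by
  obtain ⟨m, hadj, hψ⟩ := hstep y i σ
  refine ⟨m, hadj, ?_⟩
  rw [hψ, Pi.add_apply, Pi.single_eq_same, add_sub_cancel_left, ← sq]
  exact sq_nonneg _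

/-- The coarse coordinate is monotone (`0 ≤ c`, `0 < D`). [folklore] -/
theorem _root_.Summit.CriticalPhenomena.PercolationContinuityZ3.Theorems.Transplant.TwoAxis.Para.coarse_mono {c s D t t' : ℤ} (hc : 0 ≤ c)
    (hD : 0 < D) (h : t ≤ t') : TwoAxis.Para.coarse c s D t ≤ TwoAxis.Para.coarse c s D t' := by
  unfold TwoAxis.Para.coarse
  exact Int.ediv_le_ediv hD (by nlinarith)

omit [DecidableEq V] [G.LocallyFinite] in
/-- **The fine cell map has weak steps** (from `Steps` of the FINE map `φ` alone: `±e_α` moves `λ₀` by `±A·vβ` and `λ₁` by `∓A·h`, `±e_β` moves them by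
`∓A·vα`, `±A·n`; pick the sign, floors are monotone). [this work] -/
theorem weakSteps_fineSkel {φ : V → Site 2} (hstep : Steps G φ) (t : V) {A n h vα vβ c₀ c₁ s₀ s₁ D : ℤ} (hD : 0 < D) (hc₀ : 0 ≤ c₀) (hc₁ : 0 ≤ c₁) :
    WeakSteps G (fineSkel φ t A n h vα vβ c₀ c₁ s₀ s₁ D) := by
  intro y i σ
  -- coordinate 0 moves by `τ·A·vβ` under `τ e_α`; coordinate 1 by `τ·A·n` under `τ e_β`
  have key : ∀ (j : Fin 2) (d : ℤ) (L : Site 2 → ℤ) (c s : ℤ), 0 ≤ c →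
      (∀ (x : Site 2) (τ : ℤ), L (x + Pi.single j τ) = L x + τ * d) →
      ∃ m, G.Adj y m ∧ 0 ≤ (σ : ℤ) * (TwoAxis.Para.coarse c s D (L (relφ φ t m)) - TwoAxis.Para.coarse c s D (L (relφ φ t y))) := by
    intro j d L c s hc hL
    -- choose the unit `τ` with `σ·τ·d ≥ 0`
    have hτ : ∃ τ : ℤˣ, 0 ≤ (σ : ℤ) * ((τ : ℤ) * d) := by
      rcases le_or_gt 0 ((σ : ℤ) * d) with hd | hd
      · exact ⟨1, by rw [Units.val_one, one_mul]; exact hd⟩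
      · exact ⟨-1, by rw [Units.val_neg, Units.val_one, neg_one_mul, mul_neg]; linarith⟩
    obtain ⟨τ, hτd⟩ := hτ
    obtain ⟨m, hadj, hφ⟩ := hstep y j τ
    refine ⟨m, hadj, ?_⟩
    rw [relφ_of_step (t := t) hφ, hL]
    rcases Int.units_eq_one_or σ with rfl | rfl
    · rw [Units.val_one, one_mul] at hτd ⊢
      exact sub_nonneg.2 (TwoAxis.Para.coarse_mono hc hD (by linarith))
    · rw [Units.val_neg, Units.val_one, neg_one_mul] at hτd ⊢
      rw [neg_nonneg] at hτd
      rw [neg_sub, sub_nonneg]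
      exact TwoAxis.Para.coarse_mono hc hD (by linarith)
  fin_cases i
  · obtain ⟨m, hadj, hm⟩ := key 0 (A * vβ) (TwoAxis.Para.lam0 A vα vβ) c₀ s₀ hc₀ fun x τ => by
      simp [TwoAxis.Para.lam0]; ring
    exact ⟨m, hadj, by simpa [fineSkel] using hm⟩
  · obtain ⟨m, hadj, hm⟩ := key 1 (A * n) (TwoAxis.Para.lam1 A n h) c₁ s₁ hc₁ fun x τ => by
      simp [TwoAxis.Para.lam1, TwoAxis.Para.bp]; ring
    exact ⟨m, hadj, by simpa [fineSkel] using hm⟩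

omit [DecidableEq V] [G.LocallyFinite] in
/-- **Up-box step**: under `Lip` + `WeakSteps`, every vertex has a neighbour one planar level up-or-equal (level along `δ` from `cen v`) and
transversally within one. [this work] -/
theorem exists_adj_upBox (hlip : Lip G ψ) (hws : WeakSteps G ψ) (P : PCells2) (δ : MDir) (v : Site 2) (y : V) :
    ∃ m, G.Adj y m ∧ P.lev δ v (ψ y) ≤ P.lev δ v (ψ m) ∧ P.lev δ v (ψ m) ≤ P.lev δ v (ψ y) + 1 ∧ |ψ m (oth δ.1) - ψ y (oth δ.1)| ≤ 1 := by
  have hσ : ∃ σ : ℤˣ, (σ : ℤ) = sgOf δ := by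
    rcases sgOf_sign δ with h | h
    · exact ⟨1, by simp [h]⟩
    · exact ⟨-1, by simp [h]⟩
  obtain ⟨σ, hσ⟩ := hσ
  obtain ⟨m, hadj, hm⟩ := hws y δ.1 σ
  obtain ⟨h0l, h0r⟩ := abs_le.1 (hlip hadj δ.1)
  rw [hσ] at hm
  refine ⟨m, hadj, ?_, ?_, by rw [abs_sub_comm]; exact hlip hadj (oth δ.1)⟩
  · unfold PCells2.lev; rcases sgOf_sign δ with h | h <;> rw [h] at hm ⊢ <;> linarith
  · unfold PCells2.lev; rcases sgOf_sign δ with h | h <;> rw [h] <;> linarith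

omit [DecidableEq V] [G.LocallyFinite] in
/-- **Down-box step**: a neighbour one planar level down-or-equal and transversally within one. [this work] -/
theorem exists_adj_downBox (hlip : Lip G ψ) (hws : WeakSteps G ψ) (P : PCells2) (δ : MDir) (v : Site 2) (y : V) :
    ∃ m, G.Adj y m ∧ P.lev δ v (ψ m) ≤ P.lev δ v (ψ y) ∧ P.lev δ v (ψ y) - 1 ≤ P.lev δ v (ψ m) ∧ |ψ m (oth δ.1) - ψ y (oth δ.1)| ≤ 1 := by
  have hσ : ∃ σ : ℤˣ, (σ : ℤ) = -sgOf δ := by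
    rcases sgOf_sign δ with h | h
    · exact ⟨-1, by simp [h]⟩
    · exact ⟨1, by simp [h]⟩
  obtain ⟨σ, hσ⟩ := hσ
  obtain ⟨m, hadj, hm⟩ := hws y δ.1 σ
  obtain ⟨h0l, h0r⟩ := abs_le.1 (hlip hadj δ.1)
  rw [hσ] at hm
  refine ⟨m, hadj, ?_, ?_, by rw [abs_sub_comm]; exact hlip hadj (oth δ.1)⟩
  · unfold PCells2.lev; rcases sgOf_sign δ with h | h <;> rw [h] at hm ⊢ <;> linarith
  · unfold PCells2.lev; rcases sgOf_sign δ with h | h <;> rw [h] <;> linarith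

/-- **The margin method for staircase spans**: `VStair ψ A ρ ⊆ VWin ψ B r′ ∪ VWin ψ B′ r″` for a cover with the adjacency margin, `Lip ψ`, and a
profile bounded by both radii on `A`. [this work] -/
theorem VStair_subset_union_of_margin (hlip : Lip G ψ) {w₀ : V} {A B B' : Finset (Site 2)} (hM : AdjMargin A B B') {ρ : Site 2 → ℕ} {r' r'' : ℕ}
    (h' : ∀ t ∈ A, ρ t ≤ r') (h'' : ∀ t ∈ A, ρ t ≤ r'') : VStair G ψ w₀ A ρ ⊆ VWin G ψ w₀ B r' ∪ VWin G ψ w₀ B' r'' := by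
  intro y hy
  rw [VStair, mem_vspan_edgesIn_iff] at hy
  obtain ⟨hyW, z, hzW, hadj⟩ := hy
  rw [mem_stair] at hyW hzW
  rw [Finset.mem_union]
  rcases hM _ hyW.1 _ hzW.1 (supAdj_of_adj hlip hadj) with ⟨hyB, hzB⟩ | ⟨hyB, hzB⟩
  · left
    exact (mem_vspan_edgesIn_of_adj ((mem_Win G ψ).2 ⟨graphBall_mono G w₀ (h' _ hyW.1) hyW.2, hyB⟩)
      ((mem_Win G ψ).2 ⟨graphBall_mono G w₀ (h' _ hzW.1) hzW.2, hzB⟩) hadj).1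
  · right
    exact (mem_vspan_edgesIn_of_adj ((mem_Win G ψ).2 ⟨graphBall_mono G w₀ (h'' _ hyW.1) hyW.2, hyB⟩)
      ((mem_Win G ψ).2 ⟨graphBall_mono G w₀ (h'' _ hzW.1) hzW.2, hzB⟩) hadj).1

variable (G ψ)

/-! ## §2 The record with the slack far region -/

/-- **The concentric cell geometry over a (non-step) planar map, two units, slack far region**: `cellGeomSG` with `Efar := VWin (EfarN₂ …)`.
[cite: KozmaNitzan2024, §4 pp. 25–26 (Q_v, M_v, E_{v,x}, H^j_{v,x})] -/
def cellGeomSG₂ (P : PCells2) (w₀ : V) (Λ : ConcRadiiG) : CellGeom V ℕ where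
  K := P.K
  root := w₀
  a₀ := 0
  Q := fun a v => VWin G ψ w₀ (P.Q v) (Λ.rQ a v)
  M := fun a v => VWin G ψ w₀ (P.M v) (Λ.rM a v)
  Cell := fun a v => VWin G ψ w₀ (P.Cell v) (Λ.rC a v)
  Btw := fun a v δ => VWin G ψ w₀ (P.BtwN v δ) (Λ.rB a v δ)
  Efar := fun a v δ => VWin G ψ w₀ (P.EfarN₂ v δ) (Λ.rE a v δ)
  Stub := fun a v δ j => VStair G ψ w₀ (P.Stub v δ j) (prof P Λ a v δ)
  Zone := fun a v δ => VWin G ψ w₀ (P.Zone v δ) (Λ.rB a v δ)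
  col := fun x => {y | ψ y = P.cen x}
  anchor := fun a _ _ => a + 1
  anchSet := fun a _ => {a, a + 1}
  anchor_mem := fun a _ _ => Finset.mem_insert_of_mem (Finset.mem_singleton_self _)
  stub_mono := fun _ v δ _ _ h => VStair_mono (P.Stub_mono v δ h) fun _ _ => le_rfl
  hK := by have := P.hK; omega

variable {G ψ}

section Records

variable (P : PCells2) (w₀ : V) {Λ : ConcRadiiG} (hΛ : WFS2 P Λ) (hψ0 : ψ w₀ = 0)

/-! ## §3 `RunGeom`, `AnchGeom`, `SepGeom`, `SepGeom₂` -/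

/-- **`RunGeom` — automatic for spans.** [folklore] -/
theorem runGeomSG₂ : RunGeom G (cellGeomSG₂ G ψ P w₀ Λ) where
  adjQ _ _ _ hy := exists_adj_of_mem_VWin hy
  adjBtw _ _ _ _ hy := exists_adj_of_mem_VWin hy
  adjStub _ _ _ _ _ _ hy := exists_adj_of_mem_VStair hy

/-- `AnchGeom`. [folklore] -/
theorem anchGeomSG₂ : AnchGeom (cellGeomSG₂ G ψ P w₀ Λ) where
  refl a _ := Finset.mem_insert_self a {a + 1}
  const _ _ _ := rfl

include hΛ hψ0 in
/-- **`SepGeom`** over a 1-Lipschitz window map with WEAK steps: covers across a shared level by the margin method, covers across abutting levels by a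
weak step into a slack box, disjointness / separation planar; the column point is the hypothesis `hcol`. [cite: KozmaNitzan2024, §4 pp. 26–29] -/
theorem sepGeomSG₂ (hlip : Lip G ψ) (hws : WeakSteps G ψ) (hcol : ∀ a x, ∃ y ∈ VWin G ψ w₀ (P.Q x) (Λ.rQ a x), ψ y = P.cen x) :
    SepGeom G (cellGeomSG₂ G ψ P w₀ Λ) where
  anch_refl a _ := Finset.mem_insert_self a {a + 1}
  root_mem := by
    change w₀ ∈ VWin G ψ w₀ (P.Q 0) (Λ.rQ 0 0)
    obtain ⟨m, hadj, -⟩ := hws w₀ 0 1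
    have hQ : ∀ s : Site 2, (∀ i, |s i| ≤ 1) → s ∈ P.Q 0 := fun s hs => by
      rw [PCells2.Q, PCells2.mem_abox_iff]
      intro i
      have := abs_le.1 (hs i); have := P.one_le_r i
      simp only [PCells2.cen_apply, Pi.zero_apply, mul_zero]; push_cast; constructor <;> omega
    refine root_mem_VWin_of_adj (le_trans (by omega) (hΛ.colQ 0 0)) (hQ _ fun i => by rw [hψ0]; simp) hadj (hQ _ fun i => ?_)
    have := hlip hadj i; rw [hψ0, Pi.zero_apply, zero_sub, abs_neg] at this; exact this
  Q_subset_Cell a v := VWin_mono (P.Q_subset_Cell v) (hΛ.QC a a v (ConcRadiiG.WF.mem_self a))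
  Btw_subset_Cells a a' v δ ha' := by
    change VWin G ψ w₀ (P.BtwN v δ) (Λ.rB a' v δ) ⊆ VWin G ψ w₀ (P.Cell v) (Λ.rC a v) ∪ VWin G ψ w₀ (P.Cell (v + stepVec δ)) (Λ.rC a' (v + stepVec δ))
    exact VWin_subset_union_of_margin hlip (P.adjMargin_BtwN_Cells v δ) (hΛ.BC a a' v δ ha') (hΛ.BC' a' a' v δ (ConcRadiiG.WF.mem_self a'))
  Stub_subset_Q_union_Btw a a' v δ j ha' hj := by
    intro y hy
    change y ∈ VStair G ψ w₀ (P.Stub v δ j) (prof P Λ a' v δ) at hy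
    change y ∈ VWin G ψ w₀ (P.Q v) (Λ.rQ a v) ∪ VWin G ψ w₀ (P.BtwN v δ) (Λ.rB a' v δ)
    obtain ⟨hP, hd⟩ := mem_of_mem_VStair hy
    have hjK : j < P.K := by change j + 1 ≤ P.K at hj; omega
    obtain ⟨htr, hl, hu⟩ := P.bounds_of_mem_Stub hjK hP
    have hs1 : (1 : ℤ) ≤ P.s δ.1 := by exact_mod_cast P.hs δ.1
    by_cases hlev : P.lev δ v (ψ y) ≤ 5 * P.r δ.1
    · -- down-step into the cube
      obtain ⟨m, hadj, h1, h2, h3⟩ := exists_adj_downBox hlip hws P δ v y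
      have hyQ : ψ y ∈ P.Q v := P.downBox_subset_Q (htr.trans (by omega)) (by omega) hlev le_rfl (by omega) (by simp)
      have hmQ : ψ m ∈ P.Q v := P.downBox_subset_Q (htr.trans (by omega)) (by omega) hlev h1 h2 h3
      exact Finset.mem_union_left _ (mem_VWin_of_adj hd (hΛ.ρQ1 a a' v δ _ ha' hlev) hyQ hadj hmQ)
    · -- up-step into the between-box
      obtain ⟨m, hadj, h1, h2, h3⟩ := exists_adj_upBox hlip hws P δ v y
      have hyB : ψ y ∈ P.BtwN v δ := P.upBox_subset_BtwN (htr.trans (by omega)) (by omega) (by nlinarith) le_rfl (by omega) (by simp)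
      have hmB : ψ m ∈ P.BtwN v δ := P.upBox_subset_BtwN (htr.trans (by omega)) (by omega) (by nlinarith) h1 h2 h3
      exact Finset.mem_union_right _ (mem_VWin_of_adj hd (hΛ.ρB1 a' v δ _) hyB hadj hmB)
  Stub_subset_Cell_union_Zone a a' v δ j ha' hj := by
    change VStair G ψ w₀ (P.Stub v δ j) (prof P Λ a' v δ) ⊆ VWin G ψ w₀ (P.Cell v) (Λ.rC a v) ∪ VWin G ψ w₀ (P.Zone v δ) (Λ.rB a' v δ)
    have hjK : j < P.K := by change j + 1 ≤ P.K at hj; omega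
    exact VStair_subset_union_of_margin hlip (P.adjMargin_Stub_Cell_Zone v δ hjK) (fun t _ => hΛ.ρC v δ _ ha') (fun t _ => hΛ.ρB a' v δ _)
  Efar_subset_Btw_union_Q a v δ := by
    intro y hy
    change y ∈ VWin G ψ w₀ (P.EfarN₂ v δ) (Λ.rE a v δ) at hy
    change y ∈ VWin G ψ w₀ (P.BtwN v δ) (Λ.rB a v δ) ∪ VWin G ψ w₀ (P.Q (v + stepVec δ)) (Λ.rQ a (v + stepVec δ))
    have hd := mem_graphBall_of_mem_VWin hy
    have hf := φ_mem_of_mem_VWin hy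
    obtain ⟨hl, hu, htr⟩ := P.lev_bounds_of_mem_EfarN₂ hf
    have hr : (1 : ℤ) ≤ P.r δ.1 := by exact_mod_cast P.one_le_r δ.1
    by_cases hlev : P.lev δ v (ψ y) ≤ 15 * P.r δ.1 - 1
    · -- into the between-box: up from the bottom row, down otherwise
      refine Finset.mem_union_left _ ?_
      by_cases hbot : P.lev δ v (ψ y) = 5 * P.r δ.1 + 1
      · obtain ⟨m, hadj, h1, h2, h3⟩ := exists_adj_upBox hlip hws P δ v y
        have hyB : ψ y ∈ P.BtwN v δ := P.upBox_subset_BtwN htr hl (by omega) le_rfl (by omega) (by simp)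
        have hmB : ψ m ∈ P.BtwN v δ := P.upBox_subset_BtwN htr hl (by omega) h1 h2 h3
        exact mem_VWin_of_adj hd (hΛ.EB1 a v δ) hyB hadj hmB
      · obtain ⟨m, hadj, h1, h2, h3⟩ := exists_adj_downBox hlip hws P δ v y
        have hyB : ψ y ∈ P.BtwN v δ := P.downBox_subset_BtwN htr (by omega) hlev le_rfl (by omega) (by simp)
        have hmB : ψ m ∈ P.BtwN v δ := P.downBox_subset_BtwN htr (by omega) hlev h1 h2 h3
        exact mem_VWin_of_adj hd (hΛ.EB1 a v δ) hyB hadj hmB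
    · -- into the next cube: down from the top row, up otherwise
      refine Finset.mem_union_right _ ?_
      by_cases htop : P.lev δ v (ψ y) = 25 * P.r δ.1
      · obtain ⟨m, hadj, h1, h2, h3⟩ := exists_adj_downBox hlip hws P δ v y
        have hyQ : ψ y ∈ P.Q (v + stepVec δ) := P.downBox_subset_Q_add (htr.trans (by omega)) (by omega) hu le_rfl (by omega) (by simp)
        have hmQ : ψ m ∈ P.Q (v + stepVec δ) := P.downBox_subset_Q_add (htr.trans (by omega)) (by omega) hu h1 h2 h3
        exact mem_VWin_of_adj hd (hΛ.EQ1 a v δ) hyQ hadj hmQ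
      · obtain ⟨m, hadj, h1, h2, h3⟩ := exists_adj_upBox hlip hws P δ v y
        have hyQ : ψ y ∈ P.Q (v + stepVec δ) := P.upBox_subset_Q_add (htr.trans (by omega)) (by omega) (by omega) le_rfl (by omega) (by simp)
        have hmQ : ψ m ∈ P.Q (v + stepVec δ) := P.upBox_subset_Q_add (htr.trans (by omega)) (by omega) (by omega) h1 h2 h3
        exact mem_VWin_of_adj hd (hΛ.EQ1 a v δ) hyQ hadj hmQ
  Ewv_disjoint_Efar a a' w δw du hdu := by
    change Disjoint (VWin G ψ w₀ (P.BtwN w δw) (Λ.rB a w δw) ∪ VWin G ψ w₀ (P.Q (w + stepVec δw)) (Λ.rQ a (w + stepVec δw)))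
      (VWin G ψ w₀ (P.EfarN₂ (w + stepVec δw) du) (Λ.rE a' (w + stepVec δw) du))
    have h := (P.EwvN_disjoint_EfarN w hdu).mono_right (P.EfarN₂_subset_EfarN _ _)
    rw [PCells2.EwvN, Finset.disjoint_union_left] at h
    rw [Finset.disjoint_union_left]
    exact ⟨disjoint_VWin h.1 _ _, disjoint_VWin h.2 _ _⟩
  Q_disjoint_Q a a' u x hux := disjoint_VWin (P.Q_disjoint_Q hux) _ _
  Q_disjoint_Btw a a' x v δ := disjoint_VWin (P.Q_disjoint_BtwN x v δ) _ _
  Btw_disjoint_Btw a a' v δ v' δ' h1 h2 := disjoint_VWin (P.BtwN_disjoint_BtwN h1 h2) _ _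
  Q_disjoint_Efar a a' v δ := disjoint_VWin ((P.Q_disjoint_EfarN v δ).mono_right (P.EfarN₂_subset_EfarN _ _)) _ _
  Btw_disjoint_Efar a a' v δ δ' h := disjoint_VWin ((P.BtwN_disjoint_EfarN v h).mono_right (P.EfarN₂_subset_EfarN _ _)) _ _
  col_Q a x := by
    obtain ⟨y, hy, hcy⟩ := hcol a x
    exact ⟨y, hy, hcy⟩
  col_Cell a u x hux y hy hcol' := by
    change ψ y = P.cen x at hcol'
    exact P.cen_not_mem_Cell hux (hcol' ▸ φ_mem_of_mem_VWin hy)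
  col_Zone a u δ x y hy hcol' := by
    change ψ y = P.cen x at hcol'
    exact P.cen_not_mem_Zone u δ x (hcol' ▸ φ_mem_of_mem_VWin hy)

include hΛ hψ0 in
/-- **`SepGeom₂`** (cross-anchor containments), by the margin method. [cite: KozmaNitzan2024, §4 pp. 25–26] -/
theorem sepGeom₂SG₂ (hlip : Lip G ψ) (hws : WeakSteps G ψ) (hcol : ∀ a x, ∃ y ∈ VWin G ψ w₀ (P.Q x) (Λ.rQ a x), ψ y = P.cen x) :
    SepGeom₂ G (cellGeomSG₂ G ψ P w₀ Λ) where
  toSepGeom := sepGeomSG₂ P w₀ hΛ hψ0 hlip hws hcol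
  Q_subset_Cell₂ a a' x ha' := VWin_mono (P.Q_subset_Cell x) (hΛ.QC a a' x ha')
  Btw_subset_Cells₂ a a' v δ ha' := by
    change VWin G ψ w₀ (P.BtwN v δ) (Λ.rB a v δ) ⊆ VWin G ψ w₀ (P.Cell v) (Λ.rC a v) ∪ VWin G ψ w₀ (P.Cell (v + stepVec δ)) (Λ.rC a' (v + stepVec δ))
    exact VWin_subset_union_of_margin hlip (P.adjMargin_BtwN_Cells v δ) (hΛ.BC a a v δ (ConcRadiiG.WF.mem_self a)) (hΛ.BC' a a' v δ ha')

end Records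

end Skelφ

end Transplant

end Summit.CriticalPhenomena.PercolationContinuityZ3.Theorems

end
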